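import Literature.AnabelianGeometry.SemiGraphs.ProfiniteSemiGraphIsoTransportCharts
import Literature.AnabelianGeometry.SemiGraphs.Thm37AtCoveringGraph
import HarnessLib

/-!
# The bodies of [SemiAnbd] Thm 3.7 AT a graph transport along isomorphisms of profinite presentations
# (route T, TRANSPORT VII)

Mochizuki, *Semi-graphs of anabelioids*, Publ. RIMS **42** (2006), §3 Thm. 3.7 (ii)–(iv) pp. 40–41
[cite: MochizukiSemiAnbd2006, Thm 3.7(iii)(iv) pp.40-41]; the per-graph forms `CompactInVerticialAt`,
`MaximalCompactIffVerticialAt`, `EdgeLikeIsInfVerticialAt`, `EdgeLikeDistinctAt` of abc-iut-w4-d075's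
`TemperedCompactInVerticialAt.lean` (bodies of the frozen named facts with the leading `∀ 𝒢` removed).

For `F : X → Y` with `IsIso F.base` and bijective constituents (`Hom.IsLocallyTrivial`): the hypotheses of
Thm 3.7 ascend along `F` (`thm37Hypotheses_of_iso_symm`), every chart of `π₁^temp(X)` is a chart of
`π₁^temp(Y)` with the same group (abc-iut's `TemperedPiChart.transport` along `F.btempPullbackEquiv`) under which verticial / edge-like subgroups
and closed edges correspond (`ProfiniteSemiGraphIsoTransportCharts.lean`) — so each of the four bodies AT
`Y` gives the body AT `X`, and conversely along `F.inverse`: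

* `compactInVerticialAt_iff_of_iso`, `maximalCompactIffVerticialAt_iff_of_iso`,
  `edgeLikeIsInfVerticialAt_iff_of_iso`, `edgeLikeDistinctAt_iff_of_iso` (+ the one-way `_of_iso`);
* `Hom.IsoOver.thm37At_iff` — along abc-iut-L3-t3's isomorphisms OVER a base;
* `thm37At_of_isoOver_coveringHom` (`_of_finite`) — the four bodies hold AT every presentation
  isomorphic over `G` to the covering semi-graph `G_S` of a tempered covering of a coherent Thm-3.7
  graph `G` at which Thm 3.7 (iii) holds (route T `compactInVerticialAt_coveringGraph'`, abc-iut-L3-d6),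
  e.g. over every FINITE coherent Thm-3.7 graph.

Proof-only (abc-iut cell, L3 route T · TRANSPORT; seat abc-iut-L3-d6); nothing here asserts Thm 3.7
(iii) at a new class of graphs beyond transport; nothing here bears on [IUTchIII] Cor. 3.12.
-/

noncomputable section

open CategoryTheory Topology

namespace Literature.AnabelianGeometry.SemiGraphs

namespace ProfiniteSemiGraph

universe u

variable {X Y : ProfiniteSemiGraph.{u}}

/-! ### The bodies of Thm 3.7 AT a graph transport along isomorphisms of presentations -/

section AtBodies

variable (F : Hom X Y) (hlt : F.IsLocallyTrivial) [IsIso (C := SemiGraph.{u}) F.base]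

include hlt

/-- **Thm 3.7 (iii) AT `Y` gives Thm 3.7 (iii) AT `X`** for `X ≅ Y` (charts transported with the same
group, verticial / edge-like subgroups and closed edges corresponding).
[cite: MochizukiSemiAnbd2006, Thm 3.7(iii) pp.40-41] -/
theorem compactInVerticialAt_of_iso (hY : CompactInVerticialAt Y) : CompactInVerticialAt X := by
  intro h37 c C hC
  obtain ⟨h1, h2⟩ := hY (F.thm37Hypotheses_of_iso_symm hlt h37) (c.transport (F.btempPullbackEquiv hlt F.chosenConjugators)) C hC
  refine ⟨?_, fun hne v₁ v₂ H₁ H₂ hH₁ hH₂ hne12 hC₁ hC₂ => ?_⟩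
  · obtain ⟨w, H, hH, hCH⟩ := h1
    exact ⟨_, H, (c.verticialSubgroups_transport' F hlt w) ▸ hH, hCH⟩
  · obtain ⟨h3, e, L, he, hL, hCL⟩ := h2 hne (F.base.vertexMap v₁) (F.base.vertexMap v₂) H₁ H₂
      ((c.verticialSubgroups_transport F hlt v₁).symm ▸ hH₁)
      ((c.verticialSubgroups_transport F hlt v₂).symm ▸ hH₂) hne12 hC₁ hC₂
    refine ⟨fun v₃ H₃ hH₃ hC₃ => h3 (F.base.vertexMap v₃) H₃
        ((c.verticialSubgroups_transport F hlt v₃).symm ▸ hH₃) hC₃,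
      (inv (C := SemiGraph.{u}) F.base).edgeMap e, L, ?_, (c.edgeLikeSubgroups_transport' F hlt e) ▸ hL, hCL⟩
    rwa [← SemiGraph.isClosedEdge_edgeMap_iff_of_isIso F.base, SemiGraph.edgeMap_inv_edgeMap]

/-- **Thm 3.7 (iv) AT `Y` gives Thm 3.7 (iv) AT `X`.** [cite: MochizukiSemiAnbd2006, Thm 3.7(iv) p.41] -/
theorem maximalCompactIffVerticialAt_of_iso (hY : MaximalCompactIffVerticialAt Y) :
    MaximalCompactIffVerticialAt X := by
  intro h37 c
  obtain ⟨h1, h2⟩ := hY (F.thm37Hypotheses_of_iso_symm hlt h37) (c.transport (F.btempPullbackEquiv hlt F.chosenConjugators))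
  refine ⟨fun K => (h1 K).trans ⟨?_, ?_⟩, fun L hL => (h2 L hL).trans ⟨?_, ?_⟩⟩
  · rintro ⟨w, hK⟩
    exact ⟨_, (c.verticialSubgroups_transport' F hlt w) ▸ hK⟩
  · rintro ⟨v, hK⟩
    exact ⟨F.base.vertexMap v, (c.verticialSubgroups_transport F hlt v).symm ▸ hK⟩
  · rintro ⟨e, he, hL'⟩
    refine ⟨(inv (C := SemiGraph.{u}) F.base).edgeMap e, ?_, (c.edgeLikeSubgroups_transport' F hlt e) ▸ hL'⟩
    rwa [← SemiGraph.isClosedEdge_edgeMap_iff_of_isIso F.base, SemiGraph.edgeMap_inv_edgeMap]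
  · rintro ⟨e, he, hL'⟩
    exact ⟨F.base.edgeMap e, (SemiGraph.isClosedEdge_edgeMap_iff_of_isIso F.base e).2 he,
      (c.edgeLikeSubgroups_transport F hlt e).symm ▸ hL'⟩

/-- **`EdgeLikeIsInfVerticialAt Y` gives `EdgeLikeIsInfVerticialAt X`.** [cite: MochizukiSemiAnbd2006, Thm 3.7(iv) p.41] -/
theorem edgeLikeIsInfVerticialAt_of_iso (hY : EdgeLikeIsInfVerticialAt Y) : EdgeLikeIsInfVerticialAt X := by
  intro h37 c e he L hL hne
  obtain ⟨w₁, w₂, H₁, H₂, hH₁, hH₂, hne', hL'⟩ := hY (F.thm37Hypotheses_of_iso_symm hlt h37)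
    (c.transport (F.btempPullbackEquiv hlt F.chosenConjugators)) (F.base.edgeMap e) ((SemiGraph.isClosedEdge_edgeMap_iff_of_isIso F.base e).2 he) L
    ((c.edgeLikeSubgroups_transport F hlt e).symm ▸ hL) hne
  exact ⟨_, _, H₁, H₂, (c.verticialSubgroups_transport' F hlt w₁) ▸ hH₁,
    (c.verticialSubgroups_transport' F hlt w₂) ▸ hH₂, hne', hL'⟩

/-- **`EdgeLikeDistinctAt Y` gives `EdgeLikeDistinctAt X`.** [cite: MochizukiSemiAnbd2006, Thm 3.7(ii)(iv) pp.40-41] -/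
theorem edgeLikeDistinctAt_of_iso (hY : EdgeLikeDistinctAt Y) : EdgeLikeDistinctAt X := by
  intro h37 c e₁ e₂ L₁ L₂ hL₁ hL₂ hne
  exact hY (F.thm37Hypotheses_of_iso_symm hlt h37) (c.transport (F.btempPullbackEquiv hlt F.chosenConjugators)) (F.base.edgeMap e₁)
    (F.base.edgeMap e₂) L₁ L₂ ((c.edgeLikeSubgroups_transport F hlt e₁).symm ▸ hL₁)
    ((c.edgeLikeSubgroups_transport F hlt e₂).symm ▸ hL₂)
    (fun h => hne (SemiGraph.edgeMap_injective_of_isIso F.base h))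

/-- **Thm 3.7 (iii) AT a graph is invariant under isomorphisms of presentations.**
[cite: MochizukiSemiAnbd2006, Thm 3.7(iii) pp.40-41] -/
theorem compactInVerticialAt_iff_of_iso : CompactInVerticialAt X ↔ CompactInVerticialAt Y :=
  ⟨fun hX => compactInVerticialAt_of_iso (F.inverse hlt) (F.inverse_isLocallyTrivial hlt) hX,
    compactInVerticialAt_of_iso F hlt⟩

/-- **Thm 3.7 (iv) AT a graph is invariant under isomorphisms of presentations.**
[cite: MochizukiSemiAnbd2006, Thm 3.7(iv) p.41] -/
theorem maximalCompactIffVerticialAt_iff_of_iso :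
    MaximalCompactIffVerticialAt X ↔ MaximalCompactIffVerticialAt Y :=
  ⟨fun hX => maximalCompactIffVerticialAt_of_iso (F.inverse hlt) (F.inverse_isLocallyTrivial hlt) hX,
    maximalCompactIffVerticialAt_of_iso F hlt⟩

/-- `EdgeLikeIsInfVerticialAt` is invariant under isomorphisms of presentations.
[cite: MochizukiSemiAnbd2006, Thm 3.7(iv) p.41] -/
theorem edgeLikeIsInfVerticialAt_iff_of_iso : EdgeLikeIsInfVerticialAt X ↔ EdgeLikeIsInfVerticialAt Y :=
  ⟨fun hX => edgeLikeIsInfVerticialAt_of_iso (F.inverse hlt) (F.inverse_isLocallyTrivial hlt) hX,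
    edgeLikeIsInfVerticialAt_of_iso F hlt⟩

/-- `EdgeLikeDistinctAt` is invariant under isomorphisms of presentations.
[cite: MochizukiSemiAnbd2006, Thm 3.7(ii)(iv) pp.40-41] -/
theorem edgeLikeDistinctAt_iff_of_iso : EdgeLikeDistinctAt X ↔ EdgeLikeDistinctAt Y :=
  ⟨fun hX => edgeLikeDistinctAt_of_iso (F.inverse hlt) (F.inverse_isLocallyTrivial hlt) hX,
    edgeLikeDistinctAt_of_iso F hlt⟩

end AtBodies

/-! ### Along isomorphisms OVER a base; at presentations isomorphic to covering graphs -/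

/-- Along an isomorphism OVER a base (abc-iut-L3-t3's `Hom.IsoOver p q`) the hypotheses of Thm 3.7
correspond — no strict-coherence input (cf. TRANSPORT III `Hom.IsoOver.thm37Hypotheses_and_isStrictlyCoherent`).
[cite: MochizukiSemiAnbd2006, Thm 3.7 p.40] -/
theorem Hom.IsoOver.thm37Hypotheses_iff {P : ProfiniteSemiGraph.{u}} {p : Hom X P} {q : Hom Y P}
    (I : Hom.IsoOver p q) : X.Thm37Hypotheses ↔ Y.Thm37Hypotheses :=
  haveI := I.isIso_base
  ⟨I.iso.thm37Hypotheses_of_iso_symm I.isLocallyTrivial, I.iso.thm37Hypotheses_of_iso' I.isLocallyTrivial⟩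

/-- … and the hypotheses of Cor 3.9 correspond. [cite: MochizukiSemiAnbd2006, Cor 3.9 p.42] -/
theorem Hom.IsoOver.cor39Hypotheses_iff {P : ProfiniteSemiGraph.{u}} {p : Hom X P} {q : Hom Y P}
    (I : Hom.IsoOver p q) : Cor39Hypotheses X ↔ Cor39Hypotheses Y :=
  haveI := I.isIso_base
  ⟨I.iso.cor39Hypotheses_of_iso_symm I.isLocallyTrivial, I.iso.cor39Hypotheses_of_iso' I.isLocallyTrivial⟩

/-- **A presentation isomorphic over `G` to the covering semi-graph `G_S` of an object `S` of `B^cov(G)`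
satisfies the hypotheses of Thm 3.7 as soon as `G_S` does** (the transport step only; that `G_S` is a
Thm-3.7 graph for connected tempered `S` over a strictly coherent Thm-3.7 graph is route T,
`CovObj.thm37Hypotheses_coveringGraph`). [cite: MochizukiSemiAnbd2006, Thm 3.7 p.40] -/
theorem thm37Hypotheses_of_isoOver_of_coveringGraph {𝒢 : ProfiniteSemiGraph.{u}} (S : CovObj 𝒢)
    {p : Hom X 𝒢} (I : Hom.IsoOver p S.coveringHom) (h : S.coveringGraph.Thm37Hypotheses) :
    X.Thm37Hypotheses :=
  I.thm37Hypotheses_iff.2 h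

/-- **The four bodies of Thm 3.7 AT a graph are invariant under isomorphism OVER a base**
(abc-iut-L3-t3's `Hom.IsoOver p q`). [cite: MochizukiSemiAnbd2006, Thm 3.7(iii)(iv) pp.40-41] -/
theorem Hom.IsoOver.thm37At_iff {P : ProfiniteSemiGraph.{u}} {p : Hom X P} {q : Hom Y P}
    (I : Hom.IsoOver p q) :
    (CompactInVerticialAt X ↔ CompactInVerticialAt Y) ∧
      (MaximalCompactIffVerticialAt X ↔ MaximalCompactIffVerticialAt Y) ∧
      (EdgeLikeIsInfVerticialAt X ↔ EdgeLikeIsInfVerticialAt Y) ∧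
      (EdgeLikeDistinctAt X ↔ EdgeLikeDistinctAt Y) :=
  haveI := I.isIso_base
  ⟨compactInVerticialAt_iff_of_iso I.iso I.isLocallyTrivial,
    maximalCompactIffVerticialAt_iff_of_iso I.iso I.isLocallyTrivial,
    edgeLikeIsInfVerticialAt_iff_of_iso I.iso I.isLocallyTrivial,
    edgeLikeDistinctAt_iff_of_iso I.iso I.isLocallyTrivial⟩

/-- **Thm 3.7 (iii), (iv) and the edge-like corollaries AT every presentation isomorphic over `G` to the
covering semi-graph `G_S` of a tempered covering `S` of a coherent Thm-3.7 graph `G` at which Thm 3.7 (iii)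
holds** (route T `compactInVerticialAt_coveringGraph'` & co., transported) — e.g. the profinite
presentation of the source of a tempered `SgA`-arrow (abc-iut-L3-t3's `IsTemperedCoveringOf`).
[cite: MochizukiSemiAnbd2006, Thm 3.7(iii)(iv) pp.40-41] -/
theorem thm37At_of_isoOver_coveringHom {𝒢 : ProfiniteSemiGraph.{u}} (S : CovObj 𝒢) {p : Hom X 𝒢}
    (I : Hom.IsoOver p S.coveringHom) (h37 : 𝒢.Thm37Hypotheses) (hcoh : 𝒢.IsCoherent)
    (hiii : CompactInVerticialAt 𝒢) (hS : S.IsTempered) :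
    CompactInVerticialAt X ∧ MaximalCompactIffVerticialAt X ∧ EdgeLikeIsInfVerticialAt X ∧
      EdgeLikeDistinctAt X :=
  have h := I.thm37At_iff
  ⟨h.1.2 (S.compactInVerticialAt_coveringGraph' h37 hcoh hiii hS),
    h.2.1.2 (S.maximalCompactIffVerticialAt_coveringGraph' h37 hcoh hiii hS),
    h.2.2.1.2 (S.edgeLikeAt_coveringGraph' h37 hcoh hiii hS).1,
    h.2.2.2.2 (S.edgeLikeAt_coveringGraph' h37 hcoh hiii hS).2⟩

/-- The same over a FINITE coherent Thm-3.7 base graph (Thm 3.7 (iii) at finite graphs: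
`compactInVerticialAt_of_finiteGraph`). [cite: MochizukiSemiAnbd2006, Thm 3.7(iii)(iv) pp.40-41] -/
theorem thm37At_of_isoOver_coveringHom_of_finite {𝒢 : ProfiniteSemiGraph.{u}} [Finite 𝒢.graph.Vertex]
    [Finite 𝒢.graph.Edge] (S : CovObj 𝒢) {p : Hom X 𝒢} (I : Hom.IsoOver p S.coveringHom)
    (h37 : 𝒢.Thm37Hypotheses) (hcoh : 𝒢.IsCoherent) (hS : S.IsTempered) :
    CompactInVerticialAt X ∧ MaximalCompactIffVerticialAt X ∧ EdgeLikeIsInfVerticialAt X ∧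
      EdgeLikeDistinctAt X :=
  thm37At_of_isoOver_coveringHom S I h37 hcoh compactInVerticialAt_of_finiteGraph hS

end ProfiniteSemiGraph

end Literature.AnabelianGeometry.SemiGraphs

end
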